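import Literature.NumberTheory.LFunctions.CertifiedDirichletLTuringAbs
import Literature.NumberTheory.LFunctions.TuringMethodTrudgianNumericsCheck
import HarnessLib

/-!
# Turing's method for Dirichlet `L`-functions: a bound for `|∫S(t,χ)dt|` of ONE primitive character

Trudgian 2011, Theorem 3.8 / Rumely 1993, Theorem 2 bound `|∫_{t₁}^{t₂} S(t,χ) dt|` for a single
primitive `χ`; their lower bound for `∫_{1/2}^∞ log|L(σ+it,χ)| dσ` rests on the Hadamard product of
`ξ(s,χ)` (genus one).  The tree proves the lower bound for the PAIR `χ, χ̄` (even function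
`Ξ = ξ_χ ξ_χ̄`, genus-zero product; `CertifiedDirichletLTuringHadamard.lean`).  The single-character
bound nevertheless follows from the pair one and the UPPER bound for `χ̄` (Trudgian's Lemma 3.6):
`−U_χ(t) = −(U_χ + U_χ̄)(t) + U_χ̄(t)`, `U_χ(t) = ∫_{1/2}^∞ log|L(σ+it,χ)| dσ`, at the cost of the
constants (one obtains the pair constants for a single character):

* `TuringDirichlet.abs_pi_mul_integral_lfunctionArgS_single_le` — unconditional, parametric: for a
  primitive `χ` modulo `Q > 1`, `1 < c ≤ 5/4`, `½ < d ≤ 1`, `1 ≤ t₀ < t₁ ≤ t₂` (`t₁`, `t₂` ordinates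
  of no zero of `L(s,χ)L(s,χ̄)` in the critical strip),
  `π |∫_{t₁}^{t₂} S(t,χ) dt| ≤ 2(a₁ + a₂) + 2(b₁ + b₂) log(Qt₂/2π)` (constants of
  `pi_mul_integral_lfunctionArgS_pair_le`).
* `TuringDirichlet.abs_integral_lfunctionArgS_single_le_numeric'` — for `50 < t₁ ≤ t₂`:
  `|∫_{t₁}^{t₂} S(t,χ) dt| ≤ 4.52 + 0.1284 log(qt₂/2π)` (the tree's certified `ζ` numerics via
  `native_decide`; printed, with the genus-one product: Rumely `1.8397 + 0.1242 log(qt₂/2π)`,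
  Trudgian `1.975 + 0.084 log(qt₂/2π)` — typed facts `rumely1993_theorem2`, `trudgian2011_theorem33`).

## References
* T. S. Trudgian, Improvements to Turing's method, Math. Comp. 80 (2011), §3.4 Lemma 3.6,
  Theorem 3.8, §3.5. [Trudgian2011]
* R. Rumely, Math. Comp. 61 (1993), Theorem 2 p. 429. [Rumely1993ERH]
-/

noncomputable section

open Complex Set MeasureTheory intervalIntegral Filter Topology
open scoped Real

namespace Literature.NumberTheory.LFunctions

open DirichletTheta DirichletCharacter ExplicitPsiChar Trudgian2011Dirichlet TrudgianNumerics

namespace TuringDirichlet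

variable {q : ℕ} [NeZero q] {χ : DirichletCharacter ℂ q}

omit [NeZero q] in
/-- The inverse of a primitive character is primitive. [folklore] -/
private theorem isPrimitive_inv₅ (hχ : χ.IsPrimitive) : χ⁻¹.IsPrimitive := by
  rw [DirichletCharacter.isPrimitive_def, DirichletCharacter.conductor_inv]; exact hχ

omit [NeZero q] in
/-- `log(Qt/2π) = log Q + log t − log 2 − log π`. [folklore] -/
private theorem log_qt_eq₅ (hq : 0 < (q : ℝ)) {t : ℝ} (ht : 0 < t) :
    Real.log (q * t / (2 * π)) = Real.log q + Real.log t - Real.log 2 - Real.log π := by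
  rw [Real.log_div (by positivity) (by positivity), Real.log_mul hq.ne' ht.ne',
    Real.log_mul two_ne_zero Real.pi_ne_zero]
  ring

/-- `log 4 ≥ 1` (`e < 4`). [folklore] -/
private theorem one_le_log_four₅ : 1 ≤ Real.log 4 := by
  rw [Real.le_log_iff_exp_le (by norm_num)]
  have := Real.exp_one_lt_three
  linarith

/-- **One-sided single-character bound from the pair lower bound**: in the setting of
`pi_mul_integral_lfunctionArgS_pair_le'`, for `t₀ < u` and `t₀ < v` (`u`, `v` ordinates of no zero
of `L(s,χ)L(s,χ̄)` in the strip; no order between `u` and `v` assumed),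
`U_χ(v) − U_χ(u) ≤ 2(a₁ + a₂) + (b₁ + 2b₂) log(Qu/2π) + b₁ log(Qv/2π)`
(`U_χ(v) ≤ a₁ + b₁ log(Qv/2π)` by Lemma 3.6; `−U_χ(u) ≤ −(U_χ+U_χ̄)(u) + U_χ̄(u)` by the pair form of
Lemma 3.7 and Lemma 3.6 for `χ̄`). [cite: Trudgian2011, §3.4 Lemmas 3.6–3.7] -/
theorem setIntegral_log_norm_LFunction_sub_le (hq : 1 < q) (hχ : χ.IsPrimitive)
    {c d t₀ u v : ℝ} (hc1 : 1 < c) (hc : c ≤ 5 / 4) (hd : 1 / 2 < d) (hd1 : d ≤ 1) (ht₀ : 1 ≤ t₀)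
    (hu : t₀ < u) (hv : t₀ < v)
    (hzu : ∀ ρ ∈ charNontrivialZeros χ, ρ.im ≠ u) (hzu' : ∀ ρ ∈ charNontrivialZeros χ⁻¹, ρ.im ≠ u)
    (hzv : ∀ ρ ∈ charNontrivialZeros χ, ρ.im ≠ v) :
    (∫ σ in Ioi (1 / 2 : ℝ), Real.log ‖χ.LFunction (σ + v * I)‖) -
        ∫ σ in Ioi (1 / 2 : ℝ), Real.log ‖χ.LFunction (σ + u * I)‖ ≤
      2 * ((729 / (2048 * t₀ ^ 2) + (c - 1 / 2) * logZeta c + ∫ σ in Ioi c, logZeta σ) +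
          (d ^ 2 * Real.log 4 *
              ((2 * (deriv riemannZeta (2 * (1 / 2 + d) : ℝ) / riemannZeta (2 * (1 / 2 + d) : ℝ)).re -
                  (deriv riemannZeta (1 / 2 + d : ℝ) / riemannZeta (1 / 2 + d : ℝ)).re) +
                turingEps' t₀) +
            d ^ 2 * turingEps t₀ - turingI d)) +
        ((c - 1 / 2) ^ 2 / 4 + 2 * (d ^ 2 / 2 * (Real.log 4 - 1))) * Real.log (q * u / (2 * π)) +
        (c - 1 / 2) ^ 2 / 4 * Real.log (q * v / (2 * π)) := by
  have hq1 : q ≠ 1 := by omega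
  have hqR : (0 : ℝ) < q := by exact_mod_cast (show 0 < q by omega)
  have hχ' : χ⁻¹.IsPrimitive := isPrimitive_inv₅ hχ
  have ht₀0 : 0 < t₀ := by linarith
  have hu1 : 1 ≤ u := by linarith
  have hu0 : 0 < u := by linarith
  have hv0 : 0 < v := by linarith
  -- Lemma 3.6 for `χ` at `v` and for `χ̄` at `u`
  have hU := trudgian2011_lemma36 hq hχ hc1 hc ht₀0 hv hzv
  have hU' := trudgian2011_lemma36 hq hχ' hc1 hc ht₀0 hu hzu'
  -- Lemma 3.7 (pair) at `u`
  have hL := neg_setIntegral_log_norm_LFunction_pair_le Trudgian2011_lemma_2_10_holds hq hχ hd hd1 hu1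
    hzu hzu'
  -- monotonicity of the error terms
  have hε := turingEps_le ht₀0 hu.le
  have hε' := turingEps'_le ht₀0 hu.le
  have hlog4 : 0 ≤ d ^ 2 * Real.log 4 := by
    have := one_le_log_four₅; positivity
  have hd2 : 0 ≤ d ^ 2 := sq_nonneg d
  have hm1 := mul_le_mul_of_nonneg_left hε' hlog4
  have hm2 := mul_le_mul_of_nonneg_left hε hd2
  have hlogu := log_qt_eq₅ hqR hu0
  have hlogv := log_qt_eq₅ hqR hv0
  rw [hlogu, hlogv]
  rw [hlogv] at hU
  rw [hlogu] at hU'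
  linarith

/-- **Single-character Turing bound, upper side — unconditional**: for a primitive `χ` modulo
`Q > 1`, `1 < c ≤ 5/4`, `½ < d ≤ 1`, `1 ≤ t₀ < t₁ ≤ t₂`, `t₁` (resp. `t₂`) the ordinate of no zero of
`L(s,χ)L(s,χ̄)` (resp. `L(s,χ)`) with `0 < Re s < 1`:
`π ∫_{t₁}^{t₂} S(t,χ) dt ≤ 2(a₁ + a₂) + 2(b₁ + b₂) log(Qt₂/2π)` — the pair constants of
`pi_mul_integral_lfunctionArgS_pair_le`. [cite: Trudgian2011, §3.4 Theorem 3.8] -/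
theorem pi_mul_integral_lfunctionArgS_single_le (hq : 1 < q) (hχ : χ.IsPrimitive)
    {c d t₀ t₁ t₂ : ℝ} (hc1 : 1 < c) (hc : c ≤ 5 / 4) (hd : 1 / 2 < d) (hd1 : d ≤ 1) (ht₀ : 1 ≤ t₀)
    (h01 : t₀ < t₁) (h12 : t₁ ≤ t₂)
    (hz₁ : ∀ ρ ∈ charNontrivialZeros χ, ρ.im ≠ t₁) (hz₁' : ∀ ρ ∈ charNontrivialZeros χ⁻¹, ρ.im ≠ t₁)
    (hz₂ : ∀ ρ ∈ charNontrivialZeros χ, ρ.im ≠ t₂) :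
    π * ∫ t in t₁..t₂, lfunctionArgS χ t ≤
      2 * ((729 / (2048 * t₀ ^ 2) + (c - 1 / 2) * logZeta c + ∫ σ in Ioi c, logZeta σ) +
          (d ^ 2 * Real.log 4 *
              ((2 * (deriv riemannZeta (2 * (1 / 2 + d) : ℝ) / riemannZeta (2 * (1 / 2 + d) : ℝ)).re -
                  (deriv riemannZeta (1 / 2 + d : ℝ) / riemannZeta (1 / 2 + d : ℝ)).re) +
                turingEps' t₀) +
            d ^ 2 * turingEps t₀ - turingI d)) +
        2 * ((c - 1 / 2) ^ 2 / 4 + d ^ 2 / 2 * (Real.log 4 - 1)) * Real.log (q * t₂ / (2 * π)) := by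
  have hqR : (0 : ℝ) < q := by exact_mod_cast (show 0 < q by omega)
  have ht₁0 : 0 < t₁ := by linarith
  have h := setIntegral_log_norm_LFunction_sub_le hq hχ hc1 hc hd hd1 ht₀ h01 (h01.trans_le h12) hz₁
    hz₁' hz₂
  rw [pi_mul_integral_lfunctionArgS_eq hχ hq h12 hz₁ hz₂]
  have hmono : Real.log (q * t₁ / (2 * π)) ≤ Real.log (q * t₂ / (2 * π)) := by
    refine Real.log_le_log (by positivity) ?_
    gcongr
  have hb : 0 ≤ (c - 1 / 2) ^ 2 / 4 + 2 * (d ^ 2 / 2 * (Real.log 4 - 1)) := by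
    have := one_le_log_four₅
    have : 0 ≤ d ^ 2 / 2 * (Real.log 4 - 1) := mul_nonneg (by positivity) (by linarith)
    positivity
  have hm := mul_le_mul_of_nonneg_left hmono hb
  linarith

/-- **Single-character Turing bound, lower side — unconditional** (roles of `t₁`, `t₂` reversed):
`−π ∫_{t₁}^{t₂} S(t,χ) dt ≤ 2(a₁ + a₂) + 2(b₁ + b₂) log(Qt₂/2π)`; here `t₂` must be the ordinate of no
zero of `L(s,χ)L(s,χ̄)` and `t₁` of none of `L(s,χ)`. [cite: Trudgian2011, §3.4 Theorem 3.8] -/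
theorem neg_pi_mul_integral_lfunctionArgS_single_le (hq : 1 < q) (hχ : χ.IsPrimitive)
    {c d t₀ t₁ t₂ : ℝ} (hc1 : 1 < c) (hc : c ≤ 5 / 4) (hd : 1 / 2 < d) (hd1 : d ≤ 1) (ht₀ : 1 ≤ t₀)
    (h01 : t₀ < t₁) (h12 : t₁ ≤ t₂)
    (hz₁ : ∀ ρ ∈ charNontrivialZeros χ, ρ.im ≠ t₁)
    (hz₂ : ∀ ρ ∈ charNontrivialZeros χ, ρ.im ≠ t₂) (hz₂' : ∀ ρ ∈ charNontrivialZeros χ⁻¹, ρ.im ≠ t₂) :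
    -(π * ∫ t in t₁..t₂, lfunctionArgS χ t) ≤
      2 * ((729 / (2048 * t₀ ^ 2) + (c - 1 / 2) * logZeta c + ∫ σ in Ioi c, logZeta σ) +
          (d ^ 2 * Real.log 4 *
              ((2 * (deriv riemannZeta (2 * (1 / 2 + d) : ℝ) / riemannZeta (2 * (1 / 2 + d) : ℝ)).re -
                  (deriv riemannZeta (1 / 2 + d : ℝ) / riemannZeta (1 / 2 + d : ℝ)).re) +
                turingEps' t₀) +
            d ^ 2 * turingEps t₀ - turingI d)) +
        2 * ((c - 1 / 2) ^ 2 / 4 + d ^ 2 / 2 * (Real.log 4 - 1)) * Real.log (q * t₂ / (2 * π)) := by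
  have hqR : (0 : ℝ) < q := by exact_mod_cast (show 0 < q by omega)
  have ht₁0 : 0 < t₁ := by linarith
  have h := setIntegral_log_norm_LFunction_sub_le hq hχ hc1 hc hd hd1 ht₀ (h01.trans_le h12) h01 hz₂
    hz₂' hz₁
  rw [pi_mul_integral_lfunctionArgS_eq hχ hq h12 hz₁ hz₂]
  have hmono : Real.log (q * t₁ / (2 * π)) ≤ Real.log (q * t₂ / (2 * π)) := by
    refine Real.log_le_log (by positivity) ?_
    gcongr
  have hb : 0 ≤ (c - 1 / 2) ^ 2 / 4 := by positivity
  have hm := mul_le_mul_of_nonneg_left hmono hb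
  linarith

/-- **Turing's bound for ONE primitive character — unconditional, parametric** (the shape of
Trudgian 2011 Thm 3.8 / Rumely 1993 Thm 2, with the pair constants): for a primitive `χ` modulo
`Q > 1`, `1 < c ≤ 5/4`, `½ < d ≤ 1`, `1 ≤ t₀ < t₁ ≤ t₂`, `t₁`, `t₂` ordinates of no zero of
`L(s,χ)L(s,χ̄)` with `0 < Re s < 1`,
`π |∫_{t₁}^{t₂} S(t,χ) dt| ≤ 2(a₁ + a₂) + 2(b₁ + b₂) log(Qt₂/2π)`. [cite: Trudgian2011, §3.4 Theorem 3.8]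
[cite: Rumely1993ERH, Theorem 2 p. 429] -/
theorem abs_pi_mul_integral_lfunctionArgS_single_le (hq : 1 < q) (hχ : χ.IsPrimitive)
    {c d t₀ t₁ t₂ : ℝ} (hc1 : 1 < c) (hc : c ≤ 5 / 4) (hd : 1 / 2 < d) (hd1 : d ≤ 1) (ht₀ : 1 ≤ t₀)
    (h01 : t₀ < t₁) (h12 : t₁ ≤ t₂)
    (hz₁ : ∀ ρ ∈ charNontrivialZeros χ, ρ.im ≠ t₁) (hz₁' : ∀ ρ ∈ charNontrivialZeros χ⁻¹, ρ.im ≠ t₁)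
    (hz₂ : ∀ ρ ∈ charNontrivialZeros χ, ρ.im ≠ t₂) (hz₂' : ∀ ρ ∈ charNontrivialZeros χ⁻¹, ρ.im ≠ t₂) :
    π * |∫ t in t₁..t₂, lfunctionArgS χ t| ≤
      2 * ((729 / (2048 * t₀ ^ 2) + (c - 1 / 2) * logZeta c + ∫ σ in Ioi c, logZeta σ) +
          (d ^ 2 * Real.log 4 *
              ((2 * (deriv riemannZeta (2 * (1 / 2 + d) : ℝ) / riemannZeta (2 * (1 / 2 + d) : ℝ)).re -
                  (deriv riemannZeta (1 / 2 + d : ℝ) / riemannZeta (1 / 2 + d : ℝ)).re) +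
                turingEps' t₀) +
            d ^ 2 * turingEps t₀ - turingI d)) +
        2 * ((c - 1 / 2) ^ 2 / 4 + d ^ 2 / 2 * (Real.log 4 - 1)) * Real.log (q * t₂ / (2 * π)) := by
  have hup := pi_mul_integral_lfunctionArgS_single_le hq hχ hc1 hc hd hd1 ht₀ h01 h12 hz₁ hz₁' hz₂
  have hlo := neg_pi_mul_integral_lfunctionArgS_single_le hq hχ hc1 hc hd hd1 ht₀ h01 h12 hz₁ hz₂ hz₂'
  rcases le_or_gt 0 (∫ t in t₁..t₂, lfunctionArgS χ t) with h | h
  · rw [abs_of_nonneg h]; exact hup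
  · rw [abs_of_neg h, mul_neg]; exact hlo

/-- **Numerical Turing bound for ONE primitive character, granted the certified `ζ` computation**:
for a primitive `χ` modulo `q > 1`, `50 < t₁ ≤ t₂` (ordinates of no zero of `L(s,χ)L(s,χ̄)` in the
critical strip), `|∫_{t₁}^{t₂} S(t,χ) dt| ≤ 4.52 + 0.1284 log(qt₂/2π)`.
[cite: Trudgian2011, §3.5] [cite: Rumely1993ERH, Theorem 2 p. 429] -/
theorem abs_integral_lfunctionArgS_single_le_numeric_of_check (hcheck : trudgianCheck = true)
    (hq : 1 < q) (hχ : χ.IsPrimitive) {t₁ t₂ : ℝ} (h01 : 50 < t₁) (h12 : t₁ ≤ t₂)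
    (hz₁ : ∀ ρ ∈ charNontrivialZeros χ, ρ.im ≠ t₁) (hz₁' : ∀ ρ ∈ charNontrivialZeros χ⁻¹, ρ.im ≠ t₁)
    (hz₂ : ∀ ρ ∈ charNontrivialZeros χ, ρ.im ≠ t₂) (hz₂' : ∀ ρ ∈ charNontrivialZeros χ⁻¹, ρ.im ≠ t₂) :
    |∫ t in t₁..t₂, lfunctionArgS χ t| ≤ 4.52 + 0.1284 * Real.log (q * t₂ / (2 * π)) := by
  obtain ⟨I1, I2, I3, I4, ok1, okZm, okZ0, -, -, -, -⟩ := bounds_of_trudgianCheck hcheck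
  have e1 : ((11100 : ℕ) : ℝ) / 10 ^ 4 = 111 / 100 := by norm_num
  have e2 : ((300000 : ℕ) : ℝ) / 10 ^ 4 = 30 := by norm_num
  have e3 : ((12500 : ℕ) : ℝ) / 10 ^ 4 = 5 / 4 := by norm_num
  have e4 : ((25000 : ℕ) : ℝ) / 10 ^ 4 = 5 / 2 := by norm_num
  have e5 : ((20000 : ℕ) : ℝ) / 10 ^ 4 = 2 := by norm_num
  have e6 : ((40000 : ℕ) : ℝ) / 10 ^ 4 = 4 := by norm_num
  have e7 : ((12498 : ℕ) : ℝ) / 10 ^ 4 = 5 / 4 - 1 / 5000 := by norm_num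
  rw [e1, e2] at I1; rw [e3, e4] at I2; rw [e3, e5] at I3; rw [e6, e2] at I4
  have G : Real.log ‖riemannZeta (((111 / 100 : ℝ)) : ℂ)‖ ≤ 2.2696563886 := by
    have := ok1.2; simp only at this; rw [e1] at this
    refine this.trans ?_; norm_num
  have GZm : Real.log ‖riemannZeta (((5 / 4 - 1 / 5000 : ℝ)) : ℂ)‖ ≤ 1.5256867400 := by
    have := okZm.2; simp only at this; rw [e7] at this
    refine this.trans ?_; norm_num
  have GZ0 : (1.5249930917 : ℝ) ≤ Real.log ‖riemannZeta (((5 / 4 : ℝ)) : ℂ)‖ := by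
    rw [e3] at okZ0; refine le_trans ?_ okZ0; norm_num
  have hTB1 : ((TB1 : ℚ) : ℝ) = 1.4420089683 := by norm_num [TB1]
  have hTB2 : ((TB2 : ℚ) : ℝ) = 0.8393389420 := by norm_num [TB2]
  have hTB3 : ((TB3 : ℚ) : ℝ) = 0.6470996291 := by norm_num [TB3]
  have hTB4 : ((TB4 : ℚ) : ℝ) = 0.1050705446 := by norm_num [TB4]
  rw [hTB1] at I1; rw [hTB2] at I2; rw [hTB3] at I3; rw [hTB4] at I4
  have hA1 := dirichletA₁_le I1 G
  have hA2 := dirichletA₂_le I2 I3 I4 GZm GZ0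
  have hBc := dirichletB_le
  have hmain := abs_pi_mul_integral_lfunctionArgS_single_le hq hχ (c := 111 / 100) (d := 3 / 4)
    (t₀ := 50) (by norm_num) (by norm_num) (by norm_num) (by norm_num) (by norm_num) h01 h12
    hz₁ hz₁' hz₂ hz₂'
  have hq2 : (2 : ℝ) ≤ q := by exact_mod_cast hq
  have hL : 0 ≤ Real.log (q * t₂ / (2 * π)) := by
    refine Real.log_nonneg ?_
    rw [le_div_iff₀ (by positivity)]
    nlinarith [Real.pi_lt_d6]
  have hπ := Real.pi_gt_d6
  set S := |∫ t in t₁..t₂, lfunctionArgS χ t| with hS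
  set L := Real.log (q * t₂ / (2 * π)) with hLdef
  have h1 : π * S ≤ 2 * (2.826642 + 4.266146) + 2 * 0.2016703 * L := by
    have := mul_le_mul_of_nonneg_right hBc hL
    linarith
  by_contra hcon
  rw [not_le] at hcon
  have : π * (4.52 + 0.1284 * L) < π * S := mul_lt_mul_of_pos_left hcon Real.pi_pos
  nlinarith

/-- **Numerical Turing bound for ONE primitive character** (hypothesis-free; the certified `ζ`
computation enters through the tree's `native_decide` evaluation `trudgianCheck_eq_true`): for a
primitive `χ` modulo `q > 1` and `50 < t₁ ≤ t₂`, `t₁`, `t₂` ordinates of no zero of `L(s,χ)L(s,χ̄)`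
with `0 < Re s < 1`, `|∫_{t₁}^{t₂} S(t,χ) dt| ≤ 4.52 + 0.1284 log(qt₂/2π)`.
(Printed, via the genus-one Hadamard product: Rumely `1.8397 + 0.1242 log(qt₂/2π)`, Trudgian
`1.975 + 0.084 log(qt₂/2π)`.) [cite: Trudgian2011, §3.5] [cite: Rumely1993ERH, Theorem 2 p. 429] -/
theorem abs_integral_lfunctionArgS_single_le_numeric' (hq : 1 < q) (hχ : χ.IsPrimitive) {t₁ t₂ : ℝ}
    (h01 : 50 < t₁) (h12 : t₁ ≤ t₂)
    (hz₁ : ∀ ρ ∈ charNontrivialZeros χ, ρ.im ≠ t₁) (hz₁' : ∀ ρ ∈ charNontrivialZeros χ⁻¹, ρ.im ≠ t₁)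
    (hz₂ : ∀ ρ ∈ charNontrivialZeros χ, ρ.im ≠ t₂) (hz₂' : ∀ ρ ∈ charNontrivialZeros χ⁻¹, ρ.im ≠ t₂) :
    |∫ t in t₁..t₂, lfunctionArgS χ t| ≤ 4.52 + 0.1284 * Real.log (q * t₂ / (2 * π)) :=
  abs_integral_lfunctionArgS_single_le_numeric_of_check trudgianCheck_eq_true hq hχ h01 h12 hz₁ hz₁' hz₂
    hz₂'

end TuringDirichlet

end Literature.NumberTheory.LFunctions

end
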